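import Mathlib
import Summits.ValiantsHypothesis.ValiantsHypothesis.Theses.DivisionGap
import Summits.ValiantsHypothesis.ValiantsHypothesis.Theorems.DivisionGapPerCofactorDegreeReductionLogicalPosition
import Summits.ValiantsHypothesis.ValiantsHypothesis.Theorems.DivisionGapDefs
import Summits.ValiantsHypothesis.ValiantsHypothesis.Theorems.DivisionGapPerMultiplesHardStubMultihomogeneousNormalForm
import Summits.ValiantsHypothesis.ValiantsHypothesis.Theorems.PerDivisionHard.Negative.PlainBridge
import Literature.Computability.AlgebraicComplexity.ArithCircuitProofs
import Literature.Computability.AlgebraicComplexity.PermanentIrreducible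
-- wave 1 (cycle 1, all ACCEPTED): p146598, p146730, p147770, p148019 (+ p147703, p147704)
import Summits.ValiantsHypothesis.ValiantsHypothesis.Theorems.DivisionGapPerCofactorDegreeReductionStubMemberDescent
import Summits.ValiantsHypothesis.ValiantsHypothesis.Theorems.DivisionGapPerCofactorDegreeReductionStubIntrinsicJS
import Summits.ValiantsHypothesis.ValiantsHypothesis.Theorems.DivisionGapPerCofactorDegreeReductionStubCoverRung
import Summits.ValiantsHypothesis.ValiantsHypothesis.Theorems.DivisionGapPerCofactorDegreeReductionStubMatchingPadding
-- wave 2 (cycle 1, all ACCEPTED): p150035 (F1), p150209 (F2), p149782 (G), p150152 (H)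
import Summits.ValiantsHypothesis.ValiantsHypothesis.Theorems.DivisionGapPerCofactorDegreeReductionStubIsolatedStrip
import Summits.ValiantsHypothesis.ValiantsHypothesis.Theorems.DivisionGapPerCofactorDegreeReductionStubGadgetProjection
import Summits.ValiantsHypothesis.ValiantsHypothesis.Theorems.DivisionGapPerCofactorDegreeReductionStubTwoFactorRigidity
import Summits.ValiantsHypothesis.ValiantsHypothesis.Theorems.DivisionGapPerCofactorDegreeReductionStubGadgetPlacement
-- stub I (lead, ACCEPTED): p150872
import Summits.ValiantsHypothesis.ValiantsHypothesis.Theorems.DivisionGapPerCofactorDegreeReductionStubDerSumsHard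
-- wave 3 (lead c10, cycle 2 of the line, all ACCEPTED): p163839 (J), p164066 (K), p164416 (L), p164468 (M), p164626 (N)
import Summits.ValiantsHypothesis.ValiantsHypothesis.Theorems.DivisionGapPerCofactorDegreeReductionStubDominantSelfIsolation
import Summits.ValiantsHypothesis.ValiantsHypothesis.Theorems.DivisionGapPerCofactorDegreeReductionStubDominantHoleIsolation
import Summits.ValiantsHypothesis.ValiantsHypothesis.Theorems.DivisionGapPerCofactorDegreeReductionStubBlockProjection
import Summits.ValiantsHypothesis.ValiantsHypothesis.Theorems.DivisionGapPerCofactorDegreeReductionStubTwoFactorHole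
import Summits.ValiantsHypothesis.ValiantsHypothesis.Theorems.DivisionGapPerCofactorDegreeReductionStubRegularHole
-- composed rungs (lead c10, ACCEPTED): p165208
import Summits.ValiantsHypothesis.ValiantsHypothesis.Theorems.DivisionGapPerCofactorDegreeReductionDominantRungs
-- wave 4 (lead c10, all ACCEPTED): p165850 (O), p165830 (P), p165992 (Q)
import Summits.ValiantsHypothesis.ValiantsHypothesis.Theorems.DivisionGapPerCofactorDegreeReductionStubWindowOfRung
import Summits.ValiantsHypothesis.ValiantsHypothesis.Theorems.DivisionGapPerCofactorDegreeReductionStubProbeRichRung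
import Summits.ValiantsHypothesis.ValiantsHypothesis.Theorems.DivisionGapPerCofactorDegreeReductionStubDenseBlock
-- wave 5 (lead c10 + worker, all ACCEPTED): p166526 (R, S), p166773 (T)
import Summits.ValiantsHypothesis.ValiantsHypothesis.Theorems.DivisionGapPerCofactorDegreeReductionClassWindows
import Summits.ValiantsHypothesis.ValiantsHypothesis.Theorems.DivisionGapPerCofactorDegreeReductionStubProbeRichWindow
-- wave 6 (lead c10, all ACCEPTED): p168194 (U), p167679 (W), p167318 (X)
import Summits.ValiantsHypothesis.ValiantsHypothesis.Theorems.DivisionGapPerCofactorDegreeReductionStubYoungHalving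
import Summits.ValiantsHypothesis.ValiantsHypothesis.Theorems.DivisionGapPerCofactorDegreeReductionStubBlockFibre
import Summits.ValiantsHypothesis.ValiantsHypothesis.Theorems.DivisionGapPerCofactorDegreeReductionStubPureCountRung

/-!
# Skeleton — crux `DivisionGap.PerCofactorDegreeReduction` (stmt-ValiantsHypothesis-15046),
# line `Sketch_ideator4` = idea `intrinsic-member-descent` (lead a1, 2026-08-17)

The crux (PCDR): `∃ k, ∀ n, ∀ h : ℝ≥0[x_ij] (n × n), h ≠ 0 → ∃ h' ≠ 0, deg h' ≤ B ∧ L⁺(per_n · h') ≤ B`,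
`B = 2 ^ ((log₂ n + log₂ L⁺(per_n · h) + k) ^ k)`.

**Composition idea of the line (unchanged from the card).**  PCDR is the `h' = 1` corollary of
C⁺ = ExpMultiplesHard in window form, `∃ k n₀, ∀ n ≥ n₀, ∀ h ≠ 0, n ≤ (log₂ n + log₂ L⁺(per_n·h) + k)^k`
(tree: `LogicalPosition.pcdr_of_expMultiplesHard`, p142049).  C⁺ is attacked by FREE monotone moves only:

1. torus normal form (tree: `PerMultiplesHard.NormalForm.stub_multihomogeneousNormalForm`): wlog every
   monomial of `h` has the same row margins and the same column margins;
2. ONE LINE-COVERABLE MONOMIAL ⇒ done (`stub_coverRung`, the first lemma of the sister card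
   `koenig-board-shrinking`, imported into this line as its jaw for non-saturated cofactors): if some
   monomial of `h` is covered by `r` rows and `c` columns then `L⁺(per_{n−r−c}) ≤ L⁺(per_n·h) + 1`, and
   Jerrum–Snir (tree: `js_le_two_mul_complexity_perPoly`) gives `log₂ L⁺(per_n·h) ≥ n − r − c − 4`;
3. otherwise `h` is LINE-SATURATED at level `√n` (every monomial support carries a matching of size
   `> n − √n`, Kőnig) and the core stub `stub_saturatedMemberHost` supplies a monomial `u` and a host
   `G ⊇ supp u` on which the zero-restricted member `per_G · h|_G` is weakly-exponentially hard;
4. MEMBER DESCENT (`stub_memberDescent`, zero-restriction off `G` is free): `L⁺(per_G · h|_G) ≤ L⁺(per_n · h)`.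

Registered stubs: `stub_memberDescent` (LANDED p146598), `stub_intrinsicJS` (LANDED p146730, from
`RectangleBound.stub_rectangleBound`), `stub_coverRung` (LANDED p147770), `stub_matchingPadding`
(LANDED p148019 + p147703/p147704: vdW + Brégman–Minc + counting), `stub_saturatedMemberHost` (the core;
lead-held).  Reshape after wave 1 (rungs peeling named sub-classes off the core, orphans w.r.t. `_of`):
F1 `stub_isolatedStrip`, F2 `stub_gadgetProjection`, G `stub_twoFactorRigidity`, H `stub_gadgetPlacement`,
I `stub_derSumsHard` (= C⁺ for `h_der^N`-type cofactors via RIGID gadget hosts); glue `isolatedMemberRung`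
(F1 + intrinsic J–S; with `stub_matchingPadding` = C⁺ for pad-isolable monomials).
Reshape of lead c10 (2026-08-17, cycle 2 of the line): DOMINANT-MONOMIAL ISOLATION rungs J
`stub_dominantSelfIsolation`, K `stub_dominantHoleIsolation`, L `stub_blockProjection`, M
`stub_twoFactorHole`, N `stub_regularHole` (all LANDED: p163839, p164066, p164416, p164468, p164626), and the
composed rungs registered as stubs `stub_dominantHoleRung` (K + F1 + L), `stub_dominantSelfRung` (J + F1 + L),
`stub_twoFactorClassRung`/`stub_twoFactorClassHard` (M: every torus-homogeneous `h` with entries `≤ N` through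
a scaled Hamiltonian 2-factor `N • (μ_π₀ + μ_ρ₀)` has `L⁺(per_{⌊n/3⌋}) ≤ poly(n, L⁺(per_n · h))`,
strengthening I to `2^{Ω(n)}` without any hypothesis on the other monomials) and `stub_regularClassRung`
(N: complete `D`-regular `0/1` classes and their pure powers); their proofs are the lead's file
`Theorems/DivisionGapPerCofactorDegreeReductionDominantRungs.lean` (p165208).  Then (waves 4–5, all LANDED):
O `stub_windowOfRung` p165850 (closed form → window currency), P `stub_probeRichRung` p165830 (the sibling
line's `k`-cell spread engine `ZSpreadPatterns.zSpreadPatterns` as a rung: PROBE-RICH classes — complete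
classes of constant margins, truncated complete classes `T(d)^{≤b}`, 4-cycle tilings — are exponentially
hard), Q `stub_denseBlock` p165992 (dense supports carry block + matching, Hall), R `stub_denseClassRung` and
S `stub_twoFactorClassWindow` p166526, T `stub_probeRichWindow` p166773 (the rungs in the window currency of
the core), and the RECURSION toolkit U `stub_youngHalvingRung` p168194 (top form along a Young face +
projection: `L⁺(per_m · h') ≤ L⁺(per_n · h) + 1`, iterable), W `stub_blockFibreRung` p167679 (the block fibre of a
dominant monomial: `L⁺(per_m · h') ≤ poly`, K without the empty block), X `stub_pureCountRung` p167318 (the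
sibling's typed vertex count in this currency).  Open: the core only.
-/

noncomputable section

set_option linter.dupNamespace false

namespace Summit.ValiantsHypothesis.ValiantsHypothesis.Cruxes.PerCofactorDegreeReduction.IntrinsicMemberDescent

open MvPolynomial Literature.Computability.AlgebraicComplexity
open Summit.ValiantsHypothesis.ValiantsHypothesis.Theses.DivisionGap (PerCofactorDegreeReduction)
open Summit.ValiantsHypothesis.ValiantsHypothesis.Theorems.DivisionGapPerDivisionHard (facePer)
open Summit.ValiantsHypothesis.ValiantsHypothesis.Theorems.ZeroOneTransfer.Negative (topComponent)
open scoped NNReal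

/-! ## Registered stubs -/

/-- **Stub (member descent; provable now).**  Zero-restriction to a cell set `G` is a free monotone
move: substituting `x_e := 0` for `e ∉ G` maps `per_n ↦ per_G` (`facePer G`) and `h ↦ h|_G` (the
monomials of `h` supported inside `G`), is a ring homomorphism, and costs nothing
(`complexity_aeval_le` with free inputs `X e` / `C 0`). [folklore] -/
theorem stub_memberDescent :
    ∀ (n : ℕ) (h : MvPolynomial (Fin n × Fin n) ℝ≥0) (G : Finset (Fin n × Fin n)),
      complexity (facePer G *
          ∑ u ∈ h.support.filter (fun u => u.support ⊆ G), monomial u (coeff u h)) ≤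
        complexity (perPoly (Fin n) ℝ≥0 * h) :=
  Summit.ValiantsHypothesis.ValiantsHypothesis.Theorems.DivisionGap.PerCofactorDegreeReduction.MemberDescent.stub_memberDescent

/-- **Stub (intrinsic Jerrum–Snir for face permanents; provable now).**  For every host `G` with a
perfect matching (`n ≥ 3`) there is a balanced split `(S, T)` (`n/3 < |S| = |T| ≤ 2n/3`) with
`#PM(G) ≤ L⁺(per_G) · #PM(G; T → S)`, where `#PM(G; T → S)` counts the perfect matchings of `G` mapping
the columns `T` onto the rows `S`.  Route: `RectangleBound.stub_rectangleBound` (p114625) at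
`g = per_G` (margins `1`): the typed factor `a` has `0/1` row type supported on `S` and column type
supported on `T`, and `(α, β) ↦ α + β` injects `supp a × supp b` into the split-respecting matchings.
[cite: JerrumSnir1982, §4; Jukna 2023 Lemma 3.5] -/
theorem stub_intrinsicJS :
    ∀ (n : ℕ), 3 ≤ n → ∀ (G : Finset (Fin n × Fin n)),
      (∃ σ : Equiv.Perm (Fin n), ∀ i, (σ i, i) ∈ G) →
      ∃ S T : Finset (Fin n), n < 3 * S.card ∧ 3 * S.card ≤ 2 * n ∧ S.card = T.card ∧
        ((Finset.univ : Finset (Equiv.Perm (Fin n))).filter (fun σ => ∀ i, (σ i, i) ∈ G)).card ≤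
          complexity (facePer G) *
            ((Finset.univ : Finset (Equiv.Perm (Fin n))).filter
              (fun σ : Equiv.Perm (Fin n) => (∀ i, (σ i, i) ∈ G) ∧ T.image ⇑σ = S)).card :=
  Summit.ValiantsHypothesis.ValiantsHypothesis.Theorems.DivisionGap.PerCofactorDegreeReduction.IntrinsicJS.stub_intrinsicJS

/-- **Stub (cover rung; provable now — first lemma `CoverRung` of the sister card
`koenig-board-shrinking`, ideator 5).**  If ONE monomial `m` of the cofactor `h` is supported in the
union of the rows `R` and the columns `C`, then `L⁺(per_{n−|R|−|C|}) ≤ L⁺(per_n · h) + 1`: substitute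
`x := 1` on the cover lines and `x := 0` on the complementary board outside a `δ × δ` square `Q`
(`δ = n − |R| − |C|`); `per_n ↦ |R|!·|C|!·per_Q`, `h ↦ h♮` with `h♮(0) ≥ h_m > 0`; the lowest
total-degree component of the image of `per_n · h` is `|R|!|C|!h♮(0) · per_Q`, free over `ℝ≥0`
(`stub_bottomComponentFree`); unscale (one gate); rename `Q ≃ Fin δ × Fin δ`. [folklore] -/
theorem stub_coverRung :
    ∀ (n : ℕ) (h : MvPolynomial (Fin n × Fin n) ℝ≥0) (m : (Fin n × Fin n) →₀ ℕ), m ∈ h.support →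
      ∀ (R C : Finset (Fin n)), (∀ v ∈ m.support, v.1 ∈ R ∨ v.2 ∈ C) →
        complexity (perPoly (Fin (n - (R.card + C.card))) ℝ≥0) ≤
          complexity (perPoly (Fin n) ℝ≥0 * h) + 1 :=
  Summit.ValiantsHypothesis.ValiantsHypothesis.Theorems.DivisionGap.PerCofactorDegreeReduction.CoverRung.stub_coverRung

/-- **Stub (matching padding; card K2).**  For every graph `S₀` of maximum row/column degree `≤ d`
on `n ≥ n₀(d)` vertices there are `≤ 400(d+1)` permutations whose graphs, added to `S₀`, give a host
all of whose balanced splits capture at most a `2^{-n/10}` fraction of its perfect matchings.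
Route: crossing-edge concentration, Brégman–Minc on the allowed blocks, Egorychev–Falikman on the
padding. [cite: Schrijver1998; Bregman1973; Egorychev1981; Falikman1981] -/
theorem stub_matchingPadding :
    ∀ (d : ℕ), ∃ n₀ : ℕ, ∀ n ≥ n₀, ∀ (S₀ : Finset (Fin n × Fin n)),
      (∀ i : Fin n, (S₀.filter fun e => e.1 = i).card ≤ d) →
      (∀ j : Fin n, (S₀.filter fun e => e.2 = j).card ≤ d) →
      ∃ M : Finset (Equiv.Perm (Fin n)), M.card ≤ 400 * (d + 1) ∧
        ∀ S T : Finset (Fin n), n < 3 * S.card → 3 * S.card ≤ 2 * n → S.card = T.card →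
          2 ^ (n / 10) *
              ((Finset.univ : Finset (Equiv.Perm (Fin n))).filter (fun σ : Equiv.Perm (Fin n) =>
                (∀ i, (σ i, i) ∈ S₀ ∪ M.biUnion fun π => Finset.univ.image fun i => (π i, i)) ∧
                  T.image ⇑σ = S)).card ≤
            ((Finset.univ : Finset (Equiv.Perm (Fin n))).filter (fun σ : Equiv.Perm (Fin n) =>
                ∀ i, (σ i, i) ∈ S₀ ∪ M.biUnion fun π => Finset.univ.image fun i => (π i, i))).card :=
  Summit.ValiantsHypothesis.ValiantsHypothesis.Theorems.DivisionGap.PerCofactorDegreeReduction.MatchingPadding.stub_matchingPadding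

/-- **Stub F1 (isolated strip; provable now).**  If some monomial `u` of `h` is the ONLY monomial of
`h` supported inside a cell set `G ⊇ supp u`, then the face permanent of `G` is polynomially bounded
by `L⁺(per_n · h)`: member descent (`stub_memberDescent`) gives `L⁺(per_G · h_u x^u) ≤ L⁺(per_n · h)`,
unscaling costs one gate (`complexity_smul_le_holds`), and the JSS contraction
(`JssContraction.stub_jssContraction`, p88325: `L(f) ≤ ((n+2)(L(x^u f)+2))^κ`) strips `x^u`. [folklore] -/
theorem stub_isolatedStrip :
    ∃ k : ℕ, ∀ (n : ℕ) (h : MvPolynomial (Fin n × Fin n) ℝ≥0)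
      (u : (Fin n × Fin n) →₀ ℕ) (G : Finset (Fin n × Fin n)),
      u ∈ h.support → u.support ⊆ G →
      (∀ v ∈ h.support, v.support ⊆ G → v = u) →
      complexity (facePer G) ≤ ((n + 2) * (complexity (perPoly (Fin n) ℝ≥0 * h) + 3)) ^ k :=
  Summit.ValiantsHypothesis.ValiantsHypothesis.Theorems.DivisionGap.PerCofactorDegreeReduction.IsolatedStrip.stub_isolatedStrip

/-- **Stub F2 (gadget projection; provable now).**  If a cell set `A` contains a PLACED GADGET — the
complete bipartite graph `K_{b,b}` on core rows `ra a` and core columns `cb b'` with every edge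
`(a, b')` subdivided into the chord path `ra a — xc (a,b') — yr (a,b') — cb b'` (internal column
`xc`, internal row `yr`), together with a matching `c ↦ μ c` of all remaining columns to remaining rows
inside `A` — then `per_b` is a Valiant projection of `per_A = facePer A`: send `(ra a, xc (a,b')) ↦ X (a,b')`,
the other gadget cells and the cells `(μ c, c)` to `1`, everything else to `0`; the surviving perfect
matchings of `A` are in bijection with `S_b` (the set of "used" paths is a perfect matching of `K_{b,b}`).
Hence `L⁺(per_b) ≤ L⁺(per_A)` (`complexity_le_of_isProjection`). [folklore] -/
theorem stub_gadgetProjection :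
    ∀ (n b : ℕ) (A : Finset (Fin n × Fin n)) (ra cb : Fin b → Fin n)
      (xc yr : Fin b × Fin b → Fin n) (μ : Equiv.Perm (Fin n)),
      Function.Injective ra → Function.Injective cb → Function.Injective xc → Function.Injective yr →
      (∀ a p, ra a ≠ yr p) → (∀ b' p, cb b' ≠ xc p) →
      (∀ p : Fin b × Fin b, (ra p.1, xc p) ∈ A ∧ (yr p, xc p) ∈ A ∧ (yr p, cb p.2) ∈ A) →
      (∀ c : Fin n, (∀ b', cb b' ≠ c) → (∀ p, xc p ≠ c) →
        (∀ a, ra a ≠ μ c) ∧ (∀ p, yr p ≠ μ c) ∧ (μ c, c) ∈ A) →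
      complexity (perPoly (Fin b) ℝ≥0) ≤ complexity (facePer A) :=
  Summit.ValiantsHypothesis.ValiantsHypothesis.Theorems.DivisionGap.PerCofactorDegreeReduction.GadgetProjection.stub_gadgetProjection

/-- **Stub G (two-factor rigidity; provable now).**  Let `H₀ = π₀ ⊔ ρ₀` be a 2-regular host
(`π₀ i ≠ ρ₀ i`) and let every other cell of `A` be a CHORD whose endpoints are pairwise non-adjacent
in `H₀` across distinct chords (row `e'.1` of one chord is never an `H₀`-neighbour of column `e.2` of
another).  Then `H₀` is the unique simple 2-factor of `A`: any two DISJOINT perfect matchings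
`σ, τ ⊆ A` satisfy `{σ i, τ i} = {π₀ i, ρ₀ i}`.  Proof: a chord `(σ i, i)` of `σ ⊔ τ` drops an
`H₀`-edge `(r*, i)`, `r* ∈ {π₀ i, ρ₀ i} ∖ {τ i}`; row `r*` must then use a chord `(r*, c₁)` — two distinct
chords with `r*` adjacent to `i`. [folklore] -/
theorem stub_twoFactorRigidity :
    ∀ (n : ℕ) (π₀ ρ₀ : Equiv.Perm (Fin n)) (A : Finset (Fin n × Fin n)),
      (∀ i, π₀ i ≠ ρ₀ i) → (∀ i, (π₀ i, i) ∈ A ∧ (ρ₀ i, i) ∈ A) →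
      (∀ e ∈ A, ∀ e' ∈ A, π₀ e.2 ≠ e.1 → ρ₀ e.2 ≠ e.1 → π₀ e'.2 ≠ e'.1 → ρ₀ e'.2 ≠ e'.1 →
        e ≠ e' → π₀ e.2 ≠ e'.1 ∧ ρ₀ e.2 ≠ e'.1) →
      ∀ σ τ : Equiv.Perm (Fin n), (∀ i, (σ i, i) ∈ A) → (∀ i, (τ i, i) ∈ A) → (∀ i, σ i ≠ τ i) →
        ∀ i, σ i = π₀ i ∨ σ i = ρ₀ i :=
  Summit.ValiantsHypothesis.ValiantsHypothesis.Theorems.DivisionGap.PerCofactorDegreeReduction.TwoFactorRigidity.stub_twoFactorRigidity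

/-- **Stub H (gadget placement on a Hamiltonian 2-factor; provable now).**  If `H₀ = π₀ ⊔ ρ₀` is
Hamiltonian (`π₀⁻¹ρ₀` an `n`-cycle: walk column `c ↦` row `ρ₀ c ↦` column `π₀⁻¹(ρ₀ c)`), then for
`n ≥ n₀` there is a chord set making `A = H₀ ∪ chords` RIGID in the sense of `stub_twoFactorRigidity`
and containing a placed gadget of order `b = ⌊√(n/24)⌋` in the sense of `stub_gadgetProjection`:
put gadget rows at the rows `ρ₀ (τ^{6s} c₀)` and gadget columns at the columns `τ^{6s+3} c₀`
(`τ = π₀⁻¹ρ₀`; these are pairwise non-adjacent in `H₀`), use `b + b²` such slot pairs, all gadget edges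
as chords, and match the remaining vertices consecutively along `H₀` (`μ c ∈ {ρ₀ c, π₀ c}` by the phase of
the arc). [folklore] -/
theorem stub_gadgetPlacement :
    ∃ n₀ : ℕ, ∀ n ≥ n₀, ∀ (π₀ ρ₀ : Equiv.Perm (Fin n)),
      (π₀⁻¹ * ρ₀).IsCycle → (π₀⁻¹ * ρ₀).support = Finset.univ →
      ∃ A : Finset (Fin n × Fin n),
        (∀ i, (π₀ i, i) ∈ A ∧ (ρ₀ i, i) ∈ A) ∧
        (∀ e ∈ A, ∀ e' ∈ A, π₀ e.2 ≠ e.1 → ρ₀ e.2 ≠ e.1 → π₀ e'.2 ≠ e'.1 → ρ₀ e'.2 ≠ e'.1 →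
          e ≠ e' → π₀ e.2 ≠ e'.1 ∧ ρ₀ e.2 ≠ e'.1) ∧
        ∃ (ra cb : Fin (Nat.sqrt (n / 24)) → Fin n)
          (xc yr : Fin (Nat.sqrt (n / 24)) × Fin (Nat.sqrt (n / 24)) → Fin n) (μ : Equiv.Perm (Fin n)),
          Function.Injective ra ∧ Function.Injective cb ∧ Function.Injective xc ∧ Function.Injective yr ∧
          (∀ a p, ra a ≠ yr p) ∧ (∀ b' p, cb b' ≠ xc p) ∧
          (∀ p, (ra p.1, xc p) ∈ A ∧ (yr p, xc p) ∈ A ∧ (yr p, cb p.2) ∈ A) ∧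
          (∀ c : Fin n, (∀ b', cb b' ≠ c) → (∀ p, xc p ≠ c) →
            (∀ a, ra a ≠ μ c) ∧ (∀ p, yr p ≠ μ c) ∧ (μ c, c) ∈ A) :=
  Summit.ValiantsHypothesis.ValiantsHypothesis.Theorems.DivisionGap.PerCofactorDegreeReduction.GadgetPlacement.stub_gadgetPlacement

/-- **Stub I (hardness of derangement-pair sums; from F1 + F2 + G + H + Jerrum–Snir).**  C⁺ (in raw
form) for the first named member family of the shared residual: if every monomial of `h` is an
`N`-fold sum of NOWHERE-AGREEING permutation pairs `P_π + P_ρ` (e.g. `h = h_der^N`, any `N`) and some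
monomial is the pure pair-power `N·(P_{π₀} + P_{ρ₀})` with `π₀ ⊔ ρ₀` Hamiltonian, then
`b (2^{b-1} - 1) ≤ 2 ((n+2)(L⁺(per_n·h)+3))^k` with `b = ⌊√(n/24)⌋`: the rigid gadget host of
`stub_gadgetPlacement` isolates that monomial (`stub_twoFactorRigidity`: every pair inside `A` is
`{π₀, ρ₀}`), `stub_isolatedStrip` bounds `L⁺(per_A)`, `stub_gadgetProjection` extracts `per_b`, and
`js_le_two_mul_complexity_perPoly` closes. [folklore] -/
theorem stub_derSumsHard :
    ∃ k n₀ : ℕ, ∀ n ≥ n₀, ∀ (N : ℕ) (h : MvPolynomial (Fin n × Fin n) ℝ≥0) (π₀ ρ₀ : Equiv.Perm (Fin n)),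
      (π₀⁻¹ * ρ₀).IsCycle → (π₀⁻¹ * ρ₀).support = Finset.univ →
      N • (permMonomial π₀ + permMonomial ρ₀) ∈ h.support →
      (∀ v ∈ h.support, ∃ πs ρs : Fin N → Equiv.Perm (Fin n),
        (∀ k i, πs k i ≠ ρs k i) ∧ v = ∑ k, (permMonomial (πs k) + permMonomial (ρs k))) →
      Nat.sqrt (n / 24) * (2 ^ (Nat.sqrt (n / 24) - 1) - 1) ≤
        2 * ((n + 2) * (complexity (perPoly (Fin n) ℝ≥0 * h) + 3)) ^ k :=
  Summit.ValiantsHypothesis.ValiantsHypothesis.Theorems.DivisionGap.PerCofactorDegreeReduction.DerSumsHard.stub_derSumsHard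


/-! ### New rungs of lead c10: dominant-monomial isolation (stubs J, K, L, M, N)

A monomial `u` of `h` is DOMINANT if it attains the individual degree `deg_e h` on every cell of its
support (`∀ v ∈ supp h, ∀ e ∈ supp u, v e ≤ u e`); e.g. every monomial of a multilinear `h`, every pure
power `N • u₀` of a monomial of a multilinear `g` inside `h = g^N`, every monomial of `h` with entries `N`
when all entries of `h` are `≤ N`.  Dominant monomials are ISOLATED for free — in their own support when
`h` is homogeneous (J), and in their support plus any block on which they vanish when `h` is
torus-homogeneous (K) — so F1 bounds the face permanent of the host, and a matching of the complementary
lines inside `supp u` plus the full block projects that face permanent onto `per_m` (L).  M and N place the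
hole for Hamiltonian 2-factors and for regular 0/1 classes. -/

/-- **Stub J (dominant self-isolation; provable now).**  If all monomials of `h` have the total
degree of `u` and `u` dominates every monomial of `h` on `supp u`, then `u` is the only monomial of
`h` supported inside `supp u`: `v ≤ u` pointwise and `deg v = deg u` force `v = u`. [folklore] -/
theorem stub_dominantSelfIsolation :
    ∀ (n : ℕ) (h : MvPolynomial (Fin n × Fin n) ℝ≥0) (u : (Fin n × Fin n) →₀ ℕ),
      u ∈ h.support →
      (∀ v ∈ h.support, v.degree = u.degree) →
      (∀ v ∈ h.support, ∀ e ∈ u.support, v e ≤ u e) →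
      ∀ v ∈ h.support, v.support ⊆ u.support → v = u :=
  Summit.ValiantsHypothesis.ValiantsHypothesis.Theorems.DivisionGap.PerCofactorDegreeReduction.DominantSelfIsolation.stub_dominantSelfIsolation

/-- **Stub K (dominant hole-isolation; provable now).**  If `h` is torus-homogeneous (all
monomials share the row margins and the column margins), `u` dominates every monomial of `h` on
`supp u`, and `u` vanishes on the block `Vr × Vc`, then `u` is the only monomial of `h` supported
inside `supp u ∪ Vr × Vc`: on rows off `Vr` and columns off `Vc` the cells of such a `v` lie in
`supp u`, where `v ≤ u` with equal line sums forces `v = u`; the row sums of the rows in `Vr` then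
leave no mass for the block. [folklore] -/
theorem stub_dominantHoleIsolation :
    ∀ (n : ℕ) (h : MvPolynomial (Fin n × Fin n) ℝ≥0) (u : (Fin n × Fin n) →₀ ℕ)
      (Vr Vc : Finset (Fin n)),
      u ∈ h.support →
      (∃ τ : (Fin n →₀ ℕ) × (Fin n →₀ ℕ),
        ∀ m ∈ h.support, (Finsupp.mapDomain Prod.fst m, Finsupp.mapDomain Prod.snd m) = τ) →
      (∀ v ∈ h.support, ∀ e ∈ u.support, v e ≤ u e) →
      (∀ e ∈ u.support, e.1 ∈ Vr → e.2 ∉ Vc) →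
      ∀ v ∈ h.support, v.support ⊆ u.support ∪ Vr ×ˢ Vc → v = u :=
  Summit.ValiantsHypothesis.ValiantsHypothesis.Theorems.DivisionGap.PerCofactorDegreeReduction.DominantHoleIsolation.stub_dominantHoleIsolation

/-- **Stub L (block projection; provable now).**  If the cell set `A` contains the full block
`er(Fin m) × ec(Fin m)` and a matching `j ↦ (M₀ j, j)` of the columns off `ec` into rows off `er`,
injective on those columns, then `per_m` is a Valiant projection of `per_A = facePer A`: send
`x_{(er a, ec b)} ↦ X_{(a, b)}`, `x_{(M₀ j, j)} ↦ 1` (`j` off `ec`), everything else `↦ 0`; the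
surviving perfect matchings of `A` are exactly the lifts of the permutations of `Fin m`
(cf. `GadgetProjection.stub_gadgetProjection`, F2). Hence `L⁺(per_m) ≤ L⁺(per_A)`
(`complexity_le_of_isProjection`). [folklore] -/
theorem stub_blockProjection :
    ∀ (n m : ℕ) (A : Finset (Fin n × Fin n)) (er ec : Fin m → Fin n) (M₀ : Fin n → Fin n),
      Function.Injective er → Function.Injective ec →
      (∀ a b, (er a, ec b) ∈ A) →
      (∀ j, (∀ b, ec b ≠ j) → (M₀ j, j) ∈ A ∧ ∀ a, er a ≠ M₀ j) →
      (∀ j j', (∀ b, ec b ≠ j) → (∀ b, ec b ≠ j') → M₀ j = M₀ j' → j = j') →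
      complexity (perPoly (Fin m) ℝ≥0) ≤ complexity (facePer A) :=
  Summit.ValiantsHypothesis.ValiantsHypothesis.Theorems.DivisionGap.PerCofactorDegreeReduction.BlockProjection.stub_blockProjection

/-- **Stub M (hole placement on a Hamiltonian 2-factor; provable now).**  Let `H₀ = π₀ ⊔ ρ₀` be
Hamiltonian (`τ = π₀⁻¹ρ₀` an `n`-cycle), and walk it as column `c_k = τ^k c₀`, row `r_k = ρ₀ c_k`
(`r_k` is adjacent to `c_k` via `ρ₀` and to `c_{k+1}` via `π₀`).  Remove the columns `c_{3s}` and
the rows `r_{3s+1}`, `s < ⌊n/3⌋`: the block (removed rows) × (removed columns) contains no cell of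
`H₀`, and what is left of the `2n`-cycle is a union of paths each perfectly matched inside `H₀`
(`c_{3s+1} ↦ r_{3s} = π₀ c_{3s+1}`, `c_{3s+2} ↦ r_{3s+2} = ρ₀ c_{3s+2}`, and `c_k ↦ r_k` on the
tail arc `k ≥ 3⌊n/3⌋ - 1`). [folklore] -/
theorem stub_twoFactorHole :
    ∀ (n : ℕ) (π₀ ρ₀ : Equiv.Perm (Fin n)),
      (π₀⁻¹ * ρ₀).IsCycle → (π₀⁻¹ * ρ₀).support = Finset.univ →
      ∃ (er ec : Fin (n / 3) → Fin n) (M₀ : Fin n → Fin n),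
        Function.Injective er ∧ Function.Injective ec ∧
        (∀ a b, π₀ (ec b) ≠ er a ∧ ρ₀ (ec b) ≠ er a) ∧
        (∀ j, (∀ b, ec b ≠ j) → (M₀ j = π₀ j ∨ M₀ j = ρ₀ j) ∧ ∀ a, er a ≠ M₀ j) ∧
        (∀ j j', (∀ b, ec b ≠ j) → (∀ b, ec b ≠ j') → M₀ j = M₀ j' → j = j') :=
  Summit.ValiantsHypothesis.ValiantsHypothesis.Theorems.DivisionGap.PerCofactorDegreeReduction.TwoFactorHole.stub_twoFactorHole

/-- **Stub N (hole placement in a regular 0/1 class; provable now).**  For `2 ≤ D` and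
`D + 3m ≤ n` there is a `D`-regular `0/1` matrix `u₀` (the circulant with shift set
`{0, m, m+1, …, m+D-2}`: `u₀ (i, j) = 1` iff `i - j mod n` is a shift) vanishing on the block
rows `[0, m)` × columns `[m, 2m)`, together with the matching `j ↦ j` (`j ≥ 2m`, shift `0`),
`j ↦ m + j` (`j < m`, shift `m`) of the remaining columns into the remaining rows inside `supp u₀`.
[folklore] -/
theorem stub_regularHole :
    ∀ (n D m : ℕ), 2 ≤ D → D + 3 * m ≤ n →
      ∃ u₀ : (Fin n × Fin n) →₀ ℕ,
        (∀ e, u₀ e ≤ 1) ∧ (∀ i, Finsupp.mapDomain Prod.fst u₀ i = D) ∧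
        (∀ j, Finsupp.mapDomain Prod.snd u₀ j = D) ∧
        ∃ (er ec : Fin m → Fin n) (M₀ : Fin n → Fin n),
          Function.Injective er ∧ Function.Injective ec ∧
          (∀ a b, u₀ (er a, ec b) = 0) ∧
          (∀ j, (∀ b, ec b ≠ j) → u₀ (M₀ j, j) = 1 ∧ ∀ a, er a ≠ M₀ j) ∧
          (∀ j j', (∀ b, ec b ≠ j) → (∀ b, ec b ≠ j') → M₀ j = M₀ j' → j = j') :=
  Summit.ValiantsHypothesis.ValiantsHypothesis.Theorems.DivisionGap.PerCofactorDegreeReduction.RegularHole.stub_regularHole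


/-! ### Wave-2 stubs of lead c10 (LANDED p165850, p165830, p165992): window currency, probe-rich classes
(the sibling line's spread engine imported as a rung of this line), dense supports -/

/-- **Stub O (window currency of a rung; provable now).**  The closed form of the class rungs,
`⌊n/3⌋ (2^{⌊n/3⌋-1} - 1) ≤ 2 ((n+2)(s+3))^k`, in the currency of the core stub:
`n ≤ (log₂ n + log₂ s + c)^c` for `n ≥ n₀(k)`, `c = c(k)` (take logarithms: `n/3 ≤ 3 + k log₂(n+2) +
k log₂(s+3)`, and `log₂(n+2) ≤ log₂ n + 2`, `log₂(s+3) ≤ log₂ s + 3`). [folklore] -/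
theorem stub_windowOfRung :
    ∀ k : ℕ, ∃ c n₀ : ℕ, ∀ n ≥ n₀, ∀ s : ℕ,
      (n / 3) * (2 ^ (n / 3 - 1) - 1) ≤ 2 * ((n + 2) * (s + 3)) ^ k →
      n ≤ (Nat.log 2 n + Nat.log 2 s + c) ^ c :=
  Summit.ValiantsHypothesis.ValiantsHypothesis.Theorems.DivisionGap.PerCofactorDegreeReduction.WindowOfRung.stub_windowOfRung

/-- **Stub P (probe-rich classes; provable now — the sibling line's `k`-cell spread engine
`PerMultiplesHard.ZSpreadPatterns.zSpreadPatterns` as a rung of this line).**  Fix a set `Z` of `k`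
row shifts containing `1`.  If `h` is torus-homogeneous and for EVERY permutation `π` some monomial of
`h` is a `Z`-probe for `π` (all its cells `(a, b)` have `π b = ζ a` for some `ζ ∈ Z`, i.e. it lives on
the `k` permutation matrices `ζ⁻¹π`, `ζ ∈ Z`), then `per_n · h` is torus-homogeneous with all rows hit and
EVERY `π` has the `Z`-probe `μ_π + m` in `supp (per_n · h)` (`add_mem_support_mul`; the cells of `μ_π`
use the shift `1 ∈ Z`), so the engine's count is `n!` and
`n! · 3^{⌊n/(3k²)⌋} ≤ L⁺(per_n · h) · 2^{⌊n/(3k²)⌋} · n!`.  Kills every shift-complete class: complete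
classes of constant margins, their truncations `T(d)^{≤b}` (`k = ⌈d/b⌉ + 1` powers of an `n`-cycle),
4-cycle tilings, left-invariant pair classes. [folklore] -/
theorem stub_probeRichRung :
    ∀ (n k : ℕ) (Z : Finset (Equiv.Perm (Fin n))), Z.card = k → 1 ≤ k → 3 * k ≤ n →
      (1 : Equiv.Perm (Fin n)) ∈ Z →
      ∀ h : MvPolynomial (Fin n × Fin n) ℝ≥0,
        (∃ τ : (Fin n →₀ ℕ) × (Fin n →₀ ℕ),
          ∀ m ∈ h.support, (Finsupp.mapDomain Prod.fst m, Finsupp.mapDomain Prod.snd m) = τ) →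
        (∀ π : Equiv.Perm (Fin n), ∃ m ∈ h.support, ∀ e ∈ m.support, ∃ ζ ∈ Z, π e.2 = ζ e.1) →
        Nat.factorial n * 3 ^ (n / (3 * k ^ 2)) ≤
          complexity (perPoly (Fin n) ℝ≥0 * h) * (2 ^ (n / (3 * k ^ 2)) * Nat.factorial n) :=
  Summit.ValiantsHypothesis.ValiantsHypothesis.Theorems.DivisionGap.PerCofactorDegreeReduction.ProbeRichRung.stub_probeRichRung

/-- **Stub Q (dense supports carry a block and a matching; provable now).**  If every row and every
column of the cell set `G` has at least `n - t` cells, `m (t+1) + t ≤ n` and `2 (t + m) ≤ n`, then `G`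
contains a full `m × m` block `er × ec` and a matching `j ↦ (M₀ j, j)` of the columns off `ec` into the
rows off `er`, injective (the pattern of `BlockProjection.stub_blockProjection`): take any `m` rows,
then `m` columns of their common neighbourhood (each row misses `≤ t` columns), and match the remaining
`(n-m) × (n-m)` board inside `G` by Hall's theorem (its minimum degree `n - t - m` is at least half of
`n - m`). [folklore] -/
theorem stub_denseBlock :
    ∀ (n t m : ℕ) (G : Finset (Fin n × Fin n)), m * (t + 1) + t ≤ n → 2 * (t + m) ≤ n →
      (∀ i : Fin n, n - t ≤ (Finset.univ.filter fun j => (i, j) ∈ G).card) →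
      (∀ j : Fin n, n - t ≤ (Finset.univ.filter fun i => (i, j) ∈ G).card) →
      ∃ (er ec : Fin m → Fin n) (M₀ : Fin n → Fin n),
        Function.Injective er ∧ Function.Injective ec ∧
        (∀ a b, (er a, ec b) ∈ G) ∧
        (∀ j, (∀ b, ec b ≠ j) → (M₀ j, j) ∈ G ∧ ∀ a, er a ≠ M₀ j) ∧
        (∀ j j', (∀ b, ec b ≠ j) → (∀ b, ec b ≠ j') → M₀ j = M₀ j' → j = j') :=
  Summit.ValiantsHypothesis.ValiantsHypothesis.Theorems.DivisionGap.PerCofactorDegreeReduction.DenseBlock.stub_denseBlock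


/-! ### Wave-3 stubs of lead c10 (LANDED p166526, p166773): the class rungs in window currency, dense classes -/

/-- **Stub R (dense class rung; glue Q + `DominantRungs.stub_dominantSelfRung`).**  A homogeneous `h`
(all monomials of the degree of `u`) with a dominant monomial `u` whose support has at least `n - t`
cells in every row and every column forces `L⁺(per_m) ≤ ((n+2)(L⁺(per_n · h)+3))^k` whenever
`m (t+1) + t ≤ n` and `2 (t+m) ≤ n` (e.g. complements of perfect matchings: `t = 1`, `m = ⌊n/2⌋ - 1`).
[folklore] -/
theorem stub_denseClassRung :
    ∃ k : ℕ, ∀ (n t m : ℕ) (h : MvPolynomial (Fin n × Fin n) ℝ≥0) (u : (Fin n × Fin n) →₀ ℕ),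
      m * (t + 1) + t ≤ n → 2 * (t + m) ≤ n →
      u ∈ h.support →
      (∀ v ∈ h.support, v.degree = u.degree) →
      (∀ v ∈ h.support, ∀ e ∈ u.support, v e ≤ u e) →
      (∀ i : Fin n, n - t ≤ (Finset.univ.filter fun j => (i, j) ∈ u.support).card) →
      (∀ j : Fin n, n - t ≤ (Finset.univ.filter fun i => (i, j) ∈ u.support).card) →
      complexity (perPoly (Fin m) ℝ≥0) ≤
        ((n + 2) * (complexity (perPoly (Fin n) ℝ≥0 * h) + 3)) ^ k :=
  Summit.ValiantsHypothesis.ValiantsHypothesis.Theorems.DivisionGap.PerCofactorDegreeReduction.ClassWindows.stub_denseClassRung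

/-- **Stub S (two-factor classes in window currency; glue `DominantRungs.stub_twoFactorClassHard` + O).**
For `n ≥ n₀`: every torus-homogeneous `h` with entries `≤ N` (`1 ≤ N`) through a scaled Hamiltonian
2-factor `N • (μ_π₀ + μ_ρ₀)` satisfies the core's window bound `n ≤ (log₂ n + log₂ L⁺(per_n · h) + c)^c`.
[folklore] -/
theorem stub_twoFactorClassWindow :
    ∃ c n₀ : ℕ, ∀ n ≥ n₀, ∀ (N : ℕ) (h : MvPolynomial (Fin n × Fin n) ℝ≥0) (π₀ ρ₀ : Equiv.Perm (Fin n)),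
      1 ≤ N → (π₀⁻¹ * ρ₀).IsCycle → (π₀⁻¹ * ρ₀).support = Finset.univ →
      (∃ τ : (Fin n →₀ ℕ) × (Fin n →₀ ℕ),
        ∀ v ∈ h.support, (Finsupp.mapDomain Prod.fst v, Finsupp.mapDomain Prod.snd v) = τ) →
      (∀ v ∈ h.support, ∀ e, v e ≤ N) →
      N • (permMonomial π₀ + permMonomial ρ₀) ∈ h.support →
      n ≤ (Nat.log 2 n + Nat.log 2 (complexity (perPoly (Fin n) ℝ≥0 * h)) + c) ^ c :=
  Summit.ValiantsHypothesis.ValiantsHypothesis.Theorems.DivisionGap.PerCofactorDegreeReduction.ClassWindows.stub_twoFactorClassWindow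

/-- **Stub T (probe-rich classes in window currency; arithmetic on P).**  For every `k` there are
`c, n₀` such that for `n ≥ n₀`, every set `Z` of `k` row shifts containing `1` and every
torus-homogeneous `h` with a `Z`-probe for every permutation satisfy
`n ≤ (log₂ n + log₂ L⁺(per_n · h) + c)^c` (from P: `3^q ≤ L · 2^q` with `q = ⌊n/(3k²)⌋`, and
`9^q ≥ 8^q` gives `2^q ≤ L²`). [folklore] -/
theorem stub_probeRichWindow :
    ∀ k : ℕ, 1 ≤ k → ∃ c n₀ : ℕ, ∀ n ≥ n₀, ∀ (Z : Finset (Equiv.Perm (Fin n))), Z.card = k →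
      (1 : Equiv.Perm (Fin n)) ∈ Z →
      ∀ h : MvPolynomial (Fin n × Fin n) ℝ≥0,
        (∃ τ : (Fin n →₀ ℕ) × (Fin n →₀ ℕ),
          ∀ m ∈ h.support, (Finsupp.mapDomain Prod.fst m, Finsupp.mapDomain Prod.snd m) = τ) →
        (∀ π : Equiv.Perm (Fin n), ∃ m ∈ h.support, ∀ e ∈ m.support, ∃ ζ ∈ Z, π e.2 = ζ e.1) →
        n ≤ (Nat.log 2 n + Nat.log 2 (complexity (perPoly (Fin n) ℝ≥0 * h)) + c) ^ c :=
  Summit.ValiantsHypothesis.ValiantsHypothesis.Theorems.DivisionGap.PerCofactorDegreeReduction.ProbeRichWindow.stub_probeRichWindow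


/-! ### Wave-4 stubs of lead c10 (LANDED p168194, p167679, p167318): the recursion rungs (Young halving, block fibre)
and the pure count in this line's currency — the toolkit for the margins-1 class `𝒞₁` and beyond (`Lines/Sketch_ideator4.md` §c10.6) -/

/-- **Stub U (Young halving rung; provable now).**  For rows `V = eV(Fin m)` and columns `U = eU(Fin m)`
let `w` be the indicator weight of the YOUNG FACE `V × U ∪ Vᶜ × Uᶜ` of the Birkhoff polytope (it cuts out
the permutations `σ` with `σ(U) = V`; `topComponent w per_n = per_{V×U} · per_{Vᶜ×Uᶜ}`,
`FaceDescent.topComponent_perPoly_eq`).  Top components are free and multiplicative over `ℝ≥0`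
(`complexity_topComponent_le`, `topComponent_mul`), and the projection `x_e ↦ 1` off `V × U`,
`x_{(eV a, eU b)} ↦ X_{(a,b)}` sends `per_{V×U} · per_{Vᶜ×Uᶜ} · top_w h` to `(n-m)! • (per_m · h')`, where
`supp h'` is the set of restrictions to the block of the top-`w` fibre of `h`; unscaling costs one gate.
So `L⁺(per_m · h') ≤ L⁺(per_n · h) + 1` — no strip, no power: iterable `log n` times. [folklore] -/
theorem stub_youngHalvingRung :
    ∀ (n m : ℕ) (eV eU : Fin m → Fin n) (h : MvPolynomial (Fin n × Fin n) ℝ≥0),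
      Function.Injective eV → Function.Injective eU → h ≠ 0 →
      ∃ h' : MvPolynomial (Fin m × Fin m) ℝ≥0, h' ≠ 0 ∧
        (∀ w : (Fin m × Fin m) →₀ ℕ, w ∈ h'.support ↔
          ∃ v ∈ (topComponent (fun e : Fin n × Fin n =>
              if ((∃ a, eV a = e.1) ↔ (∃ b, eU b = e.2)) then 1 else 0) h).support,
            ∀ a b, w (a, b) = v (eV a, eU b)) ∧
        complexity (perPoly (Fin m) ℝ≥0 * h') ≤ complexity (perPoly (Fin n) ℝ≥0 * h) + 1 :=
  Summit.ValiantsHypothesis.ValiantsHypothesis.Theorems.DivisionGap.PerCofactorDegreeReduction.YoungHalving.stub_youngHalvingRung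

/-- **Stub W (block fibre rung; provable now — K without the empty block).**  `h` torus-homogeneous, `u`
dominant, a block `er × ec` and a matching `M₀` of the other columns into the other rows inside `supp u`.
Inside the host `A = supp u ∪ block` the monomials of `h` are exactly the BLOCK FIBRE of `u` (those `v`
with `v = u` off the block: rows off `er` / columns off `ec` carry only `u`-cells, where dominance and the
line sums force equality), so `h|_A = x^{u_off} · h_V` with `h_V` in the block variables; member descent,
the JSS strip of `x^{u_off}` and the block projection (`BlockProjection.aeval_facePer_eq_perPoly`, which
kills the off-block `u`-cells other than `M₀`'s) give `L⁺(per_m · h') ≤ ((n+2)(L⁺(per_n·h)+3))^k` for the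
transported fibre polynomial `h'` (whose support is the set of block restrictions of the fibre; it contains
the dominant `u|_block`).  `stub_dominantHoleRung` is the case `u|_block = 0`, `h' = h_u`. [folklore] -/
theorem stub_blockFibreRung :
    ∃ k : ℕ, ∀ (n m : ℕ) (h : MvPolynomial (Fin n × Fin n) ℝ≥0) (u : (Fin n × Fin n) →₀ ℕ)
      (er ec : Fin m → Fin n) (M₀ : Fin n → Fin n),
      u ∈ h.support →
      (∃ τ : (Fin n →₀ ℕ) × (Fin n →₀ ℕ),
        ∀ v ∈ h.support, (Finsupp.mapDomain Prod.fst v, Finsupp.mapDomain Prod.snd v) = τ) →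
      (∀ v ∈ h.support, ∀ e ∈ u.support, v e ≤ u e) →
      Function.Injective er → Function.Injective ec →
      (∀ j, (∀ b, ec b ≠ j) → (M₀ j, j) ∈ u.support ∧ ∀ a, er a ≠ M₀ j) →
      (∀ j j', (∀ b, ec b ≠ j) → (∀ b, ec b ≠ j') → M₀ j = M₀ j' → j = j') →
      ∃ h' : MvPolynomial (Fin m × Fin m) ℝ≥0,
        (∀ w : (Fin m × Fin m) →₀ ℕ, w ∈ h'.support ↔
          ∃ v ∈ h.support, (∀ e : Fin n × Fin n, (∀ a b, e ≠ (er a, ec b)) → v e = u e) ∧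
            ∀ a b, w (a, b) = v (er a, ec b)) ∧
        complexity (perPoly (Fin m) ℝ≥0 * h') ≤
          ((n + 2) * (complexity (perPoly (Fin n) ℝ≥0 * h) + 3)) ^ k :=
  Summit.ValiantsHypothesis.ValiantsHypothesis.Theorems.DivisionGap.PerCofactorDegreeReduction.BlockFibre.stub_blockFibreRung

/-- **Stub X (pure count in this line's currency; provable now — the sibling line's typed vertex count
`PerDivisionHard.card_pure_mul_two_pow_le` as a rung).**  If every monomial of `h` has all row and column
sums `d`, then the permutations `π` whose pure table `d • μ_π` occurs in `h` number at most
`L⁺(per_n · h) · n!/2^{⌊n/3⌋}` (`per_n · h` has margins `d+1`, contains the pure `(d+1) • μ_π`, and a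
size-`s` circuit serves `≤ s · n!/2^{⌊n/3⌋}` pure monomials). [folklore] -/
theorem stub_pureCountRung :
    ∀ (n d : ℕ) (h : MvPolynomial (Fin n × Fin n) ℝ≥0), 3 ≤ n →
      (∀ m ∈ h.support, (∀ i, ∑ j, m (i, j) = d) ∧ (∀ j, ∑ i, m (i, j) = d)) →
      ((Finset.univ : Finset (Equiv.Perm (Fin n))).filter fun π =>
          d • permMonomial π ∈ h.support).card * 2 ^ (n / 3) ≤
        complexity (perPoly (Fin n) ℝ≥0 * h) * Nat.factorial n :=
  Summit.ValiantsHypothesis.ValiantsHypothesis.Theorems.DivisionGap.PerCofactorDegreeReduction.PureCountRung.stub_pureCountRung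

/-- **Stub (the core: saturated member host; lead-held).**  C⁺ on the residual class left by the cover
rung, witnessed on a member host: for large `n`, every nonzero torus-homogeneous cofactor `h` that is
LINE-SATURATED at level `√n` (no monomial support is covered by `≤ n − √n` lines, i.e. every monomial
support carries a matching of size `> n − √n`) has a monomial `u` and a host `G ⊇ supp u` on which the
zero-restricted member `per_G · h|_G` satisfies the window bound
`n ≤ (log₂ n + log₂ L⁺(per_G · h|_G) + c) ^ c`.  Necessary for C⁺ (take `G = univ`); the line's plan
for it is member descent to `supp u ∪` padding matchings, `stub_matchingPadding`, `stub_intrinsicJS`,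
host-content strips and Kőnig purity.  Open (HY21 §6 Open Problem 3 for `per`, saturated class). -/
theorem stub_saturatedMemberHost :
    ∃ c n₀ : ℕ, ∀ n ≥ n₀, ∀ h : MvPolynomial (Fin n × Fin n) ℝ≥0, h ≠ 0 →
      (∃ τ : (Fin n →₀ ℕ) × (Fin n →₀ ℕ),
        ∀ m ∈ h.support, (Finsupp.mapDomain Prod.fst m, Finsupp.mapDomain Prod.snd m) = τ) →
      (∀ m ∈ h.support, ∀ R C : Finset (Fin n),
        (∀ v ∈ m.support, v.1 ∈ R ∨ v.2 ∈ C) → n < R.card + C.card + Nat.sqrt n) →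
      ∃ u ∈ h.support, ∃ G : Finset (Fin n × Fin n), u.support ⊆ G ∧
        n ≤ (Nat.log 2 n + Nat.log 2 (complexity (facePer G *
          ∑ v ∈ h.support.filter (fun v => v.support ⊆ G), monomial v (coeff v h))) + c) ^ c := by
  sorry

/-! ### Rungs composed from J–N (LANDED p165208, `Theorems/DivisionGapPerCofactorDegreeReductionDominantRungs.lean`, lead c10) -/

/-- **Dominant hole rung (glue: K + F1 + L).**  A torus-homogeneous `h` with a dominant monomial
`u` vanishing on an `m × m` block whose complementary lines are matched inside `supp u` forces
`L⁺(per_m) ≤ ((n+2)(L⁺(per_n · h)+3))^k`. [folklore] -/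
theorem stub_dominantHoleRung :
    ∃ k : ℕ, ∀ (n m : ℕ) (h : MvPolynomial (Fin n × Fin n) ℝ≥0) (u : (Fin n × Fin n) →₀ ℕ)
      (er ec : Fin m → Fin n) (M₀ : Fin n → Fin n),
      u ∈ h.support →
      (∃ τ : (Fin n →₀ ℕ) × (Fin n →₀ ℕ),
        ∀ v ∈ h.support, (Finsupp.mapDomain Prod.fst v, Finsupp.mapDomain Prod.snd v) = τ) →
      (∀ v ∈ h.support, ∀ e ∈ u.support, v e ≤ u e) →
      Function.Injective er → Function.Injective ec →
      (∀ a b, u (er a, ec b) = 0) →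
      (∀ j, (∀ b, ec b ≠ j) → (M₀ j, j) ∈ u.support ∧ ∀ a, er a ≠ M₀ j) →
      (∀ j j', (∀ b, ec b ≠ j) → (∀ b, ec b ≠ j') → M₀ j = M₀ j' → j = j') →
      complexity (perPoly (Fin m) ℝ≥0) ≤
        ((n + 2) * (complexity (perPoly (Fin n) ℝ≥0 * h) + 3)) ^ k :=
  Summit.ValiantsHypothesis.ValiantsHypothesis.Theorems.DivisionGap.PerCofactorDegreeReduction.DominantRungs.stub_dominantHoleRung

/-- **Dominant self rung (glue: J + F1 + L).**  A homogeneous `h` (all monomials of the degree of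
`u`) with a dominant monomial `u` whose support contains a full `m × m` block and a matching of the
complementary lines forces `L⁺(per_m) ≤ ((n+2)(L⁺(per_n · h)+3))^k`. [folklore] -/
theorem stub_dominantSelfRung :
    ∃ k : ℕ, ∀ (n m : ℕ) (h : MvPolynomial (Fin n × Fin n) ℝ≥0) (u : (Fin n × Fin n) →₀ ℕ)
      (er ec : Fin m → Fin n) (M₀ : Fin n → Fin n),
      u ∈ h.support →
      (∀ v ∈ h.support, v.degree = u.degree) →
      (∀ v ∈ h.support, ∀ e ∈ u.support, v e ≤ u e) →
      Function.Injective er → Function.Injective ec →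
      (∀ a b, (er a, ec b) ∈ u.support) →
      (∀ j, (∀ b, ec b ≠ j) → (M₀ j, j) ∈ u.support ∧ ∀ a, er a ≠ M₀ j) →
      (∀ j j', (∀ b, ec b ≠ j) → (∀ b, ec b ≠ j') → M₀ j = M₀ j' → j = j') →
      complexity (perPoly (Fin m) ℝ≥0) ≤
        ((n + 2) * (complexity (perPoly (Fin n) ℝ≥0 * h) + 3)) ^ k :=
  Summit.ValiantsHypothesis.ValiantsHypothesis.Theorems.DivisionGap.PerCofactorDegreeReduction.DominantRungs.stub_dominantSelfRung

/-- **Two-factor class rung (glue: M + dominant hole rung).**  If `h` is torus-homogeneous with all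
entries `≤ N` (`1 ≤ N`) and contains the scaled Hamiltonian 2-factor `N • (μ_π₀ + μ_ρ₀)`
(`π₀⁻¹ρ₀` an `n`-cycle) — e.g. `h = h_der^N`, or any multilinear 2-regular class through a
Hamiltonian cycle — then `L⁺(per_{⌊n/3⌋}) ≤ ((n+2)(L⁺(per_n · h)+3))^k`; no hypothesis on the other
monomials of `h` is needed (compare stub I). [folklore] -/
theorem stub_twoFactorClassRung :
    ∃ k : ℕ, ∀ (n N : ℕ) (h : MvPolynomial (Fin n × Fin n) ℝ≥0) (π₀ ρ₀ : Equiv.Perm (Fin n)),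
      1 ≤ N → (π₀⁻¹ * ρ₀).IsCycle → (π₀⁻¹ * ρ₀).support = Finset.univ →
      (∃ τ : (Fin n →₀ ℕ) × (Fin n →₀ ℕ),
        ∀ v ∈ h.support, (Finsupp.mapDomain Prod.fst v, Finsupp.mapDomain Prod.snd v) = τ) →
      (∀ v ∈ h.support, ∀ e, v e ≤ N) →
      N • (permMonomial π₀ + permMonomial ρ₀) ∈ h.support →
      complexity (perPoly (Fin (n / 3)) ℝ≥0) ≤
        ((n + 2) * (complexity (perPoly (Fin n) ℝ≥0 * h) + 3)) ^ k :=
  Summit.ValiantsHypothesis.ValiantsHypothesis.Theorems.DivisionGap.PerCofactorDegreeReduction.DominantRungs.stub_twoFactorClassRung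

/-- **Two-factor classes are exponentially hard (closed form).**  Under the hypotheses of
`twoFactorClassRung` and `6 ≤ n`: `⌊n/3⌋ (2^{⌊n/3⌋-1} - 1) ≤ 2 ((n+2)(L⁺(per_n · h)+3))^k`
(Jerrum–Snir on `per_{⌊n/3⌋}`). [folklore] -/
theorem stub_twoFactorClassHard :
    ∃ k : ℕ, ∀ (n N : ℕ) (h : MvPolynomial (Fin n × Fin n) ℝ≥0) (π₀ ρ₀ : Equiv.Perm (Fin n)),
      6 ≤ n → 1 ≤ N → (π₀⁻¹ * ρ₀).IsCycle → (π₀⁻¹ * ρ₀).support = Finset.univ →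
      (∃ τ : (Fin n →₀ ℕ) × (Fin n →₀ ℕ),
        ∀ v ∈ h.support, (Finsupp.mapDomain Prod.fst v, Finsupp.mapDomain Prod.snd v) = τ) →
      (∀ v ∈ h.support, ∀ e, v e ≤ N) →
      N • (permMonomial π₀ + permMonomial ρ₀) ∈ h.support →
      (n / 3) * (2 ^ (n / 3 - 1) - 1) ≤
        2 * ((n + 2) * (complexity (perPoly (Fin n) ℝ≥0 * h) + 3)) ^ k :=
  Summit.ValiantsHypothesis.ValiantsHypothesis.Theorems.DivisionGap.PerCofactorDegreeReduction.DominantRungs.stub_twoFactorClassHard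

/-- **Regular 0/1 classes are exponentially hard (glue: N + dominant hole rung).**  If `h` is
torus-homogeneous with all entries `≤ N` (`1 ≤ N`) and contains `N • u₀` for EVERY `D`-regular
`0/1` matrix `u₀` (`2 ≤ D`) — e.g. `h = g^N` for the complete `D`-regular multilinear class `g`, the
sibling line's multiplicity test object — then `L⁺(per_m) ≤ ((n+2)(L⁺(per_n · h)+3))^k` whenever
`D + 3m ≤ n`. [folklore] -/
theorem stub_regularClassRung :
    ∃ k : ℕ, ∀ (n D m N : ℕ) (h : MvPolynomial (Fin n × Fin n) ℝ≥0),
      2 ≤ D → D + 3 * m ≤ n → 1 ≤ N →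
      (∃ τ : (Fin n →₀ ℕ) × (Fin n →₀ ℕ),
        ∀ v ∈ h.support, (Finsupp.mapDomain Prod.fst v, Finsupp.mapDomain Prod.snd v) = τ) →
      (∀ v ∈ h.support, ∀ e, v e ≤ N) →
      (∀ u₀ : (Fin n × Fin n) →₀ ℕ, (∀ e, u₀ e ≤ 1) →
        (∀ i, Finsupp.mapDomain Prod.fst u₀ i = D) → (∀ j, Finsupp.mapDomain Prod.snd u₀ j = D) →
        N • u₀ ∈ h.support) →
      complexity (perPoly (Fin m) ℝ≥0) ≤
        ((n + 2) * (complexity (perPoly (Fin n) ℝ≥0 * h) + 3)) ^ k :=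
  Summit.ValiantsHypothesis.ValiantsHypothesis.Theorems.DivisionGap.PerCofactorDegreeReduction.DominantRungs.stub_regularClassRung

/-! ## Glue (no `sorry` below this line) -/

/-- Monotonicity of the window bound in the exponent parameter: `(a + c)^c ≤ (a + k)^k` for
`c ≤ k`, `1 ≤ k`. [folklore] -/
theorem window_mono {a c k : ℕ} (hck : c ≤ k) (hk : 1 ≤ k) : (a + c) ^ c ≤ (a + k) ^ k :=
  (Nat.pow_le_pow_left (by omega) c).trans (Nat.pow_le_pow_right (by omega) hck)

/-- **Isolated-member rung (glue: F1 + intrinsic Jerrum–Snir).**  If `u` is the only monomial of `h`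
inside a host `G ⊇ supp u` with a perfect matching, then `#PM(G) ≤ ((n+2)(L⁺(per_n·h)+3))^k · #PM(G; T→S)`
for some balanced split; with `stub_matchingPadding` (host `supp u ∪ pads`, `2^{n/10}·#split ≤ #PM`) this is
C⁺ for cofactors with a pad-isolable bounded-degree monomial. [folklore] -/
theorem isolatedMemberRung :
    ∃ k : ℕ, ∀ (n : ℕ), 3 ≤ n → ∀ (h : MvPolynomial (Fin n × Fin n) ℝ≥0)
      (u : (Fin n × Fin n) →₀ ℕ) (G : Finset (Fin n × Fin n)),
      u ∈ h.support → u.support ⊆ G →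
      (∀ v ∈ h.support, v.support ⊆ G → v = u) →
      (∃ σ : Equiv.Perm (Fin n), ∀ i, (σ i, i) ∈ G) →
      ∃ S T : Finset (Fin n), n < 3 * S.card ∧ 3 * S.card ≤ 2 * n ∧ S.card = T.card ∧
        ((Finset.univ : Finset (Equiv.Perm (Fin n))).filter (fun σ => ∀ i, (σ i, i) ∈ G)).card ≤
          ((n + 2) * (complexity (perPoly (Fin n) ℝ≥0 * h) + 3)) ^ k *
            ((Finset.univ : Finset (Equiv.Perm (Fin n))).filter
              (fun σ : Equiv.Perm (Fin n) => (∀ i, (σ i, i) ∈ G) ∧ T.image ⇑σ = S)).card := by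
  obtain ⟨k, hk⟩ := stub_isolatedStrip
  refine ⟨k, fun n hn h u G hu huG hiso hpm => ?_⟩
  obtain ⟨S, T, h1, h2, h3, h4⟩ := stub_intrinsicJS n hn G hpm
  exact ⟨S, T, h1, h2, h3, h4.trans (Nat.mul_le_mul_right _ (hk n h u G hu huG hiso))⟩


/-- The non-saturated branch in window currency: from `L⁺(per_δ) ≤ s + 1` with `δ ≥ 4` one gets
`δ ≤ log₂ s + 4` (Jerrum–Snir `δ (2^{δ-1} - 1) ≤ 2 L⁺(per_δ)`). [folklore] -/
theorem delta_le_log_of_coverRung {δ s : ℕ} (hδ : 4 ≤ δ)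
    (hL : complexity (perPoly (Fin δ) ℝ≥0) ≤ s + 1) : δ ≤ Nat.log 2 s + 4 := by
  have hjs := Summit.ValiantsHypothesis.Theorems.PerDivisionHardNegative.js_le_two_mul_complexity_perPoly
    (n := δ) (by omega)
  -- `δ (2^{δ-1} - 1) ≤ 2 (s + 1)`
  have h1 : δ * (2 ^ (δ - 1) - 1) ≤ 2 * (s + 1) := hjs.trans (Nat.mul_le_mul_left 2 hL)
  obtain ⟨e, rfl⟩ : ∃ e, δ = e + 4 := ⟨δ - 4, by omega⟩
  have hpow : 2 ^ (e + 4 - 1) = 8 * 2 ^ e := by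
    rw [show e + 4 - 1 = e + 3 by omega, pow_add]; ring
  rw [hpow] at h1
  set P := 2 ^ e with hP
  have hpos : 1 ≤ P := Nat.one_le_two_pow
  have h4 : 4 * (8 * P - 1) ≤ (e + 4) * (8 * P - 1) := Nat.mul_le_mul_right _ (by omega)
  have h5 : 4 * (8 * P - 1) ≤ 2 * (s + 1) := h4.trans h1
  have h2 : P ≤ s := by omega
  have h3 : e ≤ Nat.log 2 s := Nat.le_log_of_pow_le (by norm_num) h2
  omega

/-- **C⁺ = ExpMultiplesHard (window form) from the stubs.** [folklore] -/
theorem expMultiplesHard_of_stubs :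
    ∃ k n₀ : ℕ, ∀ n ≥ n₀, ∀ h : MvPolynomial (Fin n × Fin n) ℝ≥0, h ≠ 0 →
      n ≤ (Nat.log 2 n + Nat.log 2 (complexity (perPoly (Fin n) ℝ≥0 * h)) + k) ^ k := by
  classical
  obtain ⟨c, n₀, hcore⟩ := stub_saturatedMemberHost
  refine ⟨max c 5, max n₀ 16, fun n hn h hh => ?_⟩
  have hn₀ : n₀ ≤ n := le_of_max_le_left hn
  have hn16 : 16 ≤ n := le_of_max_le_right hn
  set s := complexity (perPoly (Fin n) ℝ≥0 * h) with hs
  -- torus normal form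
  obtain ⟨h', hh', -, hτ, hL', -⟩ :=
    Summit.ValiantsHypothesis.ValiantsHypothesis.Theorems.DivisionGap.PerMultiplesHard.NormalForm.stub_multihomogeneousNormalForm
      n h hh
  rw [← hs] at hL'
  have hk1 : 1 ≤ max c 5 := le_max_of_le_right (by norm_num)
  by_cases hsat : ∀ m ∈ h'.support, ∀ R C : Finset (Fin n),
      (∀ v ∈ m.support, v.1 ∈ R ∨ v.2 ∈ C) → n < R.card + C.card + Nat.sqrt n
  · -- saturated: core stub on a member host, then member descent
    obtain ⟨u, -, G, -, hwin⟩ := hcore n hn₀ h' hh' hτ hsat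
    have hmd := stub_memberDescent n h' G
    calc n ≤ _ := hwin
      _ ≤ (Nat.log 2 n + Nat.log 2 s + c) ^ c := by
          gcongr
          exact hmd.trans hL'
      _ ≤ (Nat.log 2 n + Nat.log 2 s + max c 5) ^ (max c 5) := window_mono (le_max_left _ _) hk1
  · -- one line-coverable monomial: cover rung + Jerrum–Snir
    push Not at hsat
    obtain ⟨m, hm, R, C, hcov, hle⟩ := hsat
    have hrung := stub_coverRung n h' m hm R C hcov
    set δ := n - (R.card + C.card) with hδ
    have hsqrt4 : 4 ≤ Nat.sqrt n := by
      rw [Nat.le_sqrt]; omega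
    have hδ4 : 4 ≤ δ := by omega
    have hδlog : δ ≤ Nat.log 2 s + 4 :=
      delta_le_log_of_coverRung hδ4 (hrung.trans (Nat.add_le_add_right hL' 1))
    have hsq : Nat.sqrt n ≤ Nat.log 2 s + 4 := by omega
    have hn_lt : n < (Nat.sqrt n + 1) ^ 2 := by
      have := Nat.lt_succ_sqrt n
      nlinarith [this]
    calc n ≤ (Nat.sqrt n + 1) ^ 2 := hn_lt.le
      _ ≤ (Nat.log 2 n + Nat.log 2 s + 5) ^ 2 := Nat.pow_le_pow_left (by omega) 2
      _ ≤ (Nat.log 2 n + Nat.log 2 s + 5) ^ 5 := Nat.pow_le_pow_right (by omega) (by norm_num)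
      _ ≤ (Nat.log 2 n + Nat.log 2 s + max c 5) ^ (max c 5) := window_mono (le_max_right _ _) hk1

/-- **Composition (audited skeleton theorem).**  Concludes the crux
`DivisionGap.PerCofactorDegreeReduction` BY NAME from the registered stubs via C⁺ and the tree glue
`LogicalPosition.pcdr_of_expMultiplesHard` (witness `h' = 1`). -/
theorem PerCofactorDegreeReduction_of :
    Summit.ValiantsHypothesis.ValiantsHypothesis.Theses.DivisionGap.PerCofactorDegreeReduction :=
  Summit.ValiantsHypothesis.ValiantsHypothesis.Theorems.DivisionGap.PerCofactorDegreeReduction.LogicalPosition.pcdr_of_expMultiplesHard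
    expMultiplesHard_of_stubs

end Summit.ValiantsHypothesis.ValiantsHypothesis.Cruxes.PerCofactorDegreeReduction.IntrinsicMemberDescent

end
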